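import Literature.Claims.NS.AlZawahreh2026

/-!
# C111 `AlZawahreh2026` — refuter kernel facts (D-0090 NS-CLAIMS; refuter-8)

Over the typed skeleton `Literature.Claims.NS.AlZawahreh2026` (typist-12, p470474; Zenodo
10.5281/zenodo.18974531 + repository `merchantmoh-debug/Navier-Stokes-Lean-4-Solution`, `src/NS_Core/`):

* `not_axiom_energyDissipation_euclidean` / `not_axiomAll` — the artefact's AXIOM `energy_dissipation`
  (NavierStokes.lean l.60–62), the only non-trivial conjunct of its top theorem `global_regularity_ns`
  (GlobalRegularity.lean l.53–70: `viscosity > 0 ∧ True ∧ energy_dissipation`), read as a statement, is FALSE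
  over the artefact's own definitions: `NSEvolution E = {u, u₀, u 0 = u₀}` imposes no dynamics, so the family
  jumping from a unit vector `e` to `2 • e` after time `0` violates `kineticEnergy (u t) ≤ kineticEnergy u₀`
  at `t = 1` (energies `2` vs `1/2`), in every nontrivial carrier (here `EuclideanSpace ℝ (Fin 1)`, and
  generally any `E` with a nonzero vector).
* `not_capstoneAll` — hence the transcribed top theorem is false as a statement (`capstoneAll_iff_axiomAll`),
  and `step_bridge_holds` — the bridge «top theorem ⇒ the paper's sentence» holds VACUOUSLY (skeleton's
  `step_bridge_of_not_capstoneAll`): the composition `claim_of_steps : AxiomAll → Step_bridge → ClaimedTheorem`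
  has a refuted first hypothesis.

WHAT THIS IS NOT: not a claim about NS regularity or blow-up; not a claim about any author beyond the typed locator.
-/

set_option linter.dupNamespace false

noncomputable section

namespace Summit.NavierStokesRegularity.NavierStokesRegularity.Theorems.AlZawahreh2026

open Literature.Claims.NS.AlZawahreh2026

/-- In ANY carrier with a nonzero vector the artefact's energy axiom fails: the `NSEvolution`
`u t := if t = 0 then ⟨e⟩ else ⟨2 • e⟩`, `u₀ := ⟨e⟩` has `kineticEnergy (u 1) = 2‖e‖² > ‖e‖²/2`. -/
theorem not_axiom_energyDissipation_of_ne_zero {E : Type*} [NormedAddCommGroup E] [InnerProductSpace ℝ E]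
    [FiniteDimensional ℝ E] (e : E) (he : e ≠ 0) : ¬ Axiom_energyDissipation E := by
  intro h
  classical
  let sol : NSEvolution E :=
    { u := fun t => if t = 0 then ⟨e⟩ else ⟨(2 : ℝ) • e⟩, u₀ := ⟨e⟩, initial := by simp }
  have h1 := h sol 1 one_pos
  simp only [sol, kineticEnergy, one_ne_zero, if_false, norm_smul, Real.norm_ofNat] at h1
  have hn : 0 < ‖e‖ := norm_pos_iff.mpr he
  nlinarith

/-- The axiom fails in the concrete finite-dimensional inner-product space `ℝ¹ = EuclideanSpace ℝ (Fin 1)`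
(the artefact's «E represents ℝ^(3N)», NavierStokes.lean l.21–24). -/
theorem not_axiom_energyDissipation_euclidean :
    ¬ Axiom_energyDissipation (EuclideanSpace ℝ (Fin 1)) := by
  refine not_axiom_energyDissipation_of_ne_zero (EuclideanSpace.single 0 1) ?_
  intro h
  have := congrArg (fun f : EuclideanSpace ℝ (Fin 1) => f 0) h
  simp at this

/-- **The artefact's axiom `energy_dissipation`, universally over admissible carriers as declared
(`variable {E : Type*} [NormedAddCommGroup E] [InnerProductSpace ℝ E] [FiniteDimensional ℝ E]`), is false.** -/
theorem not_axiomAll : ¬ Literature.Claims.NS.AlZawahreh2026.AxiomAll :=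
  fun h => not_axiom_energyDissipation_euclidean (h (EuclideanSpace ℝ (Fin 1)))

/-- **The transcribed top theorem `global_regularity_ns` is false as a statement** (its third conjunct is
the axiom; `capstoneAll_iff_axiomAll`). -/
theorem not_capstoneAll : ¬ Literature.Claims.NS.AlZawahreh2026.CapstoneAll :=
  fun h => not_axiomAll (capstoneAll_iff_axiomAll.mp h)

/-- The top theorem already fails at the single carrier `ℝ¹`. -/
theorem not_capstone_euclidean : ¬ Capstone (EuclideanSpace ℝ (Fin 1)) :=
  fun h => not_axiom_energyDissipation_euclidean (capstone_iff_axiom.mp h)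

/-- **Vacuity record**: the bridge «top theorem ⇒ the paper's Main Theorem» (§6.4 p.5 «Main theorem:
global_regularity_ns»; GlobalRegularity.lean l.37–52 docstring) holds for the trivial reason that its
hypothesis is refuted — the skeleton's `step_bridge_of_not_capstoneAll` applied to `not_capstoneAll`. -/
theorem step_bridge_holds : Step_bridge :=
  step_bridge_of_not_capstoneAll not_capstoneAll

end Summit.NavierStokesRegularity.NavierStokesRegularity.Theorems.AlZawahreh2026

end
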